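import Summits.ValiantsHypothesis.ValiantsHypothesis.Theorems.LacunarySymmetroidMatrixDescartesFiniteSectorStampCeilingFifteenFiveA
import Summits.ValiantsHypothesis.ValiantsHypothesis.Theorems.LacunarySymmetroidMatrixDescartesFiniteSectorStampCeilingFifteenFiveB
import Summits.ValiantsHypothesis.ValiantsHypothesis.Theorems.LacunarySymmetroidMatrixDescartesFiniteSectorStampCeilingFifteenFiveC
import Summits.ValiantsHypothesis.ValiantsHypothesis.Theorems.LacunarySymmetroidMatrixDescartesFiniteSectorStampCeilingFifteenFiveD
import Summits.ValiantsHypothesis.ValiantsHypothesis.Theorems.LacunarySymmetroidMatrixDescartesFiniteSectorStampCeilingFifteenFiveE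
import Summits.ValiantsHypothesis.ValiantsHypothesis.Theorems.LacunarySymmetroidMatrixDescartesFiniteSectorStampCeilingFifteenFiveF
import Summits.ValiantsHypothesis.ValiantsHypothesis.Theorems.LacunarySymmetroidMatrixDescartesFiniteSectorStampCeilingFifteenFiveG
import Summits.ValiantsHypothesis.ValiantsHypothesis.Theorems.LacunarySymmetroidMatrixDescartesFiniteSectorStampCeilingFifteenFiveH
import Summits.ValiantsHypothesis.ValiantsHypothesis.Theorems.LacunarySymmetroidMatrixDescartesFiniteSectorStampCeilingFifteenFiveI
import Summits.ValiantsHypothesis.ValiantsHypothesis.Theorems.LacunarySymmetroidMatrixDescartesFiniteSectorStampCeilingFifteenFiveJ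
import Summits.ValiantsHypothesis.ValiantsHypothesis.Theorems.LacunarySymmetroidMatrixDescartesFiniteSectorStampCeilingFifteenFiveK
import Summits.ValiantsHypothesis.ValiantsHypothesis.Theorems.LacunarySymmetroidMatrixDescartesFiniteSectorStampCeilingFifteenFiveL
import Summits.ValiantsHypothesis.ValiantsHypothesis.Theorems.LacunarySymmetroidMatrixDescartesFiniteSectorStampCeilingFifteenFiveM
import Summits.ValiantsHypothesis.ValiantsHypothesis.Theorems.LacunarySymmetroidMatrixDescartesFiniteSectorSumMasksHigherSix

/-!
# `MatrixDescartes` — line «stamp»: the STAMP CEILING `ν(15,5) ≤ 1383 = n(15,4)` (kernel) — `StampLawAt 15 5 1383`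

HONEST FRAMING.  Object-search cell `pub-symmetroid`, seat val-sym-door-p5 g10 (generators of val-sym-door-p5 g8/g9 VERBATIM, m-tables extended to m ≤ 19; fold binders typed `(x acc : ℕ)` — same elaborated terms, fast elaboration).  HELPER of the crux item `stmt-ValiantsHypothesis-18050` with NO closure claim.
T3 (`mem_sumset_of_fullPos`) makes every `r ≤ deg` of a full-positive-rooted symmetric `15 × 15` half-pencil with `5` terms an `15`-fold sum of exponents; the
values `0, 1` occur, and the capped, padded, sorted value set must cover `[0, deg]`; the finite core — no `4` denominations with `15` stamps cover `[0, 1384]`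
(`n(15,4) = 1383`) — has 136797 live prefixes and is decided in the kernel in SLICES by the third and fourth values `(a,b)` (`a ≤ 16`, `b ≤ 15a + 1` forced by
the cover at `16` and `15a + 1`; dead pairs in that range are refuted by `decide` on the prefix atom): slices in
`…FiniteSectorStampCeilingFifteenFiveA`, `…FiniteSectorStampCeilingFifteenFiveB`, `…FiniteSectorStampCeilingFifteenFiveC`, `…FiniteSectorStampCeilingFifteenFiveD`, `…FiniteSectorStampCeilingFifteenFiveE`, `…FiniteSectorStampCeilingFifteenFiveF`, `…FiniteSectorStampCeilingFifteenFiveG`, `…FiniteSectorStampCeilingFifteenFiveH`, `…FiniteSectorStampCeilingFifteenFiveI`, `…FiniteSectorStampCeilingFifteenFiveJ`, `…FiniteSectorStampCeilingFifteenFiveK`, `…FiniteSectorStampCeilingFifteenFiveL`, `…FiniteSectorStampCeilingFifteenFiveM` (this file holds the transfer only); `15`-fold sums as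
iterated shift-form bitmasks.  Result: `stampLawAt_fifteen_five : StampLawAt 15 5 1383`.  Located first (exact DFS, this seat): best reach of `4` denominations with `15`
stamps = `1383` (e.g. {1,12,65,240}).  Nothing here bears on the crux (asymptotic), on the doors, or on `VP ≠ VNP`.
[folklore] Postage-stamp bookkeeping on the proved T3 (Guy UPINT C12; Challis / Mossige tables); no citation is load-bearing.
-/

-- `Summit.ValiantsHypothesis.ValiantsHypothesis.…` repeats a component by the D-0017 layout
-- (single-conjunct summit), which the `dupNamespace` linter flags; the name is mandated.
set_option linter.dupNamespace false

namespace Summit.ValiantsHypothesis.ValiantsHypothesis.Theorems.LacunarySymmetroidMatrixDescartes.FiniteSector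

open scoped BigOperators Matrix
open Polynomial

/-! ## `(15,5)`: `ν(15,5) ≤ n(15,4) = 1383` — the transfer -/

set_option maxHeartbeats 4000000 in
/-- **`ν(15,5) ≤ 1383 = n(15,4)`** — `StampLawAt 15 5 1383`: every full-positive-rooted symmetric `15 × 15` half-pencil determinant with `5` terms has
degree `≤ 1383` (T3 ⇒ every `r ≤ deg` is an `15`-fold sum; values `0, 1` forced; capped at `1385`, padded, sorted; `a ≤ 16`, `b ≤ 15a + 1`; bitmasks; the slice checks). [folklore] -/
theorem stampLawAt_fifteen_five : StampLawAt 15 5 1383 := by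
  intro d S hS hfull
  by_contra hdeg'
  have hdeg : 1383 < (pencil d S).det.natDegree := not_le.mp hdeg'
  have hq : (pencil d S).det ≠ 0 := by
    intro h0
    rw [h0] at hdeg
    simp at hdeg
  have hmem : ∀ r, r ≤ (pencil d S).det.natDegree → ∃ i j k l n o q i₁ j₁ k₁ l₁ n₁ o₁ q₁ i₂ : Fin 5, d i + d j + d k + d l + d n + d o + d q + d i₁ + d j₁ + d k₁ + d l₁ + d n₁ + d o₁ + d q₁ + d i₂ = r := by
    intro r hr
    have hm := mem_sumset_of_fullPos d S hq hfull hr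
    rw [Finset.mem_image] at hm
    obtain ⟨s, -, hs⟩ := hm
    obtain ⟨i, j, k, l, n, o, q, i₁, j₁, k₁, l₁, n₁, o₁, q₁, i₂, h15⟩ := exists_sum_eq_of_card_fifteen d (s : Multiset (Fin 5)) s.2
    exact ⟨i, j, k, l, n, o, q, i₁, j₁, k₁, l₁, n₁, o₁, q₁, i₂, by omega⟩
  set cv : Fin 5 → ℕ := fun i => min (d i) 1385 with hcv
  have hcvd : ∀ i, d i ≤ 1384 → cv i = d i := fun i hi => by
    simp only [hcv]
    exact Nat.min_eq_left (by omega)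
  have hcvle : ∀ i, cv i ≤ 1385 := fun i => Nat.min_le_right _ _
  set V : Finset ℕ := Finset.univ.image cv with hV
  have hcvV : ∀ i, cv i ∈ V := fun i => Finset.mem_image_of_mem cv (Finset.mem_univ i)
  have h0V : 0 ∈ V := by
    obtain ⟨i, j, k, l, n, o, q, i₁, j₁, k₁, l₁, n₁, o₁, q₁, i₂, hh⟩ := hmem 0 (Nat.zero_le _)
    have : cv i = 0 := by rw [hcvd i (by omega)]; omega
    exact this ▸ hcvV i
  have h1V : 1 ∈ V := by
    obtain ⟨i, j, k, l, n, o, q, i₁, j₁, k₁, l₁, n₁, o₁, q₁, i₂, hh⟩ := hmem 1 (by omega)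
    have key : ∃ t : Fin 5, d t = 1 := by
      by_contra hne; simp only [not_exists] at hne; have hz0 : d i = 0 := (by have := hne i; omega); have hz1 : d j = 0 := (by have := hne j; omega); have hz2 : d k = 0 := (by have := hne k; omega); have hz3 : d l = 0 := (by have := hne l; omega); have hz4 : d n = 0 := (by have := hne n; omega); have hz5 : d o = 0 := (by have := hne o; omega); have hz6 : d q = 0 := (by have := hne q; omega); have hz7 : d i₁ = 0 := (by have := hne i₁; omega); have hz8 : d j₁ = 0 := (by have := hne j₁; omega); have hz9 : d k₁ = 0 := (by have := hne k₁; omega); have hz10 : d l₁ = 0 := (by have := hne l₁; omega); have hz11 : d n₁ = 0 := (by have := hne n₁; omega); have hz12 : d o₁ = 0 := (by have := hne o₁; omega); have hz13 : d q₁ = 0 := (by have := hne q₁; omega); have hz14 : d i₂ = 0 := (by have := hne i₂; omega); omega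
    obtain ⟨t, ht⟩ := key
    have : cv t = 1 := by rw [hcvd t (by omega)]; omega
    exact this ▸ hcvV t
  have h1V' : 1 ∈ V.erase 0 := Finset.mem_erase.mpr ⟨by norm_num, h1V⟩
  set W : Finset ℕ := (V.erase 0).erase 1 with hW
  have hWsub : W ⊆ ((Finset.range 1386).erase 0).erase 1 := by
    intro u hu
    rw [hW, Finset.mem_erase, Finset.mem_erase] at hu
    obtain ⟨hu1, hu0, huV⟩ := hu
    rw [hV, Finset.mem_image] at huV
    obtain ⟨i, -, rfl⟩ := huV
    rw [Finset.mem_erase, Finset.mem_erase, Finset.mem_range]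
    exact ⟨hu1, hu0, Nat.lt_succ_of_le (hcvle i)⟩
  have hWcard : W.card ≤ 3 := by
    have hVK : V.card ≤ 5 := by
      have := Finset.card_image_le (s := (Finset.univ : Finset (Fin 5))) (f := cv)
      simpa using this
    have h1 : (V.erase 0).card + 1 = V.card := Finset.card_erase_add_one h0V
    have h2 : W.card + 1 = (V.erase 0).card := by rw [hW]; exact Finset.card_erase_add_one h1V'
    omega
  obtain ⟨W', hWW', hW'sub, hW'card⟩ := Finset.exists_subsuperset_card_eq hWsub hWcard (by
    rw [Finset.card_erase_of_mem (by simp), Finset.card_erase_of_mem (by simp), Finset.card_range]; omega)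
  have hVW' : ∀ u ∈ V, u = 0 ∨ u = 1 ∨ u ∈ W' := by
    intro u hu
    by_cases hu0 : u = 0
    · exact Or.inl hu0
    by_cases hu1 : u = 1
    · exact Or.inr (Or.inl hu1)
    · exact Or.inr (Or.inr (hWW' (by rw [hW, Finset.mem_erase, Finset.mem_erase]; exact ⟨hu1, hu0, hu⟩)))
  have hlmem : ∀ u, u ∈ Finset.sort W' ↔ u ∈ W' := fun u => Finset.mem_sort _
  have hlsort : (Finset.sort W').SortedLT := Finset.sortedLT_sort W'
  have hllen : (Finset.sort W').length = 3 := by rw [Finset.length_sort, hW'card]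
  generalize hl : Finset.sort W' = l at hlmem hlsort hllen
  rcases l with _ | ⟨a, _ | ⟨b, _ | ⟨c, _ | ⟨zz, ll⟩⟩⟩⟩
  all_goals simp only [List.length_cons, List.length_nil] at hllen
  all_goals try omega
  have hmemR : ∀ u, u ∈ [a, b, c] → u ∈ List.range 1386 := by
    intro u hu
    have hu' : u ∈ W' := (hlmem u).mp hu
    have := hW'sub hu'
    rw [Finset.mem_erase, Finset.mem_erase, Finset.mem_range] at this
    exact List.mem_range.mpr this.2.2
  have hgt1 : ∀ u, u ∈ [a, b, c] → 1 < u := by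
    intro u hu
    have hu' : u ∈ W' := (hlmem u).mp hu
    have := hW'sub hu'
    rw [Finset.mem_erase, Finset.mem_erase] at this
    omega
  have h1a : 1 < a := hgt1 a (by simp)
  have hmemP : ∀ r, r ≤ 1384 → (∃ i j k l n o q i₁ j₁ k₁ l₁ n₁ o₁ q₁ i₂ : Fin 5, d i + d j + d k + d l + d n + d o + d q + d i₁ + d j₁ + d k₁ + d l₁ + d n₁ + d o₁ + d q₁ + d i₂ = r) → (∃ x ∈ [0, 1, a, b, c], ∃ y ∈ [0, 1, a, b, c], ∃ z ∈ [0, 1, a, b, c], ∃ w ∈ [0, 1, a, b, c], ∃ v ∈ [0, 1, a, b, c], ∃ o ∈ [0, 1, a, b, c], ∃ t ∈ [0, 1, a, b, c], ∃ e₁ ∈ [0, 1, a, b, c], ∃ e₂ ∈ [0, 1, a, b, c], ∃ e₃ ∈ [0, 1, a, b, c], ∃ e₄ ∈ [0, 1, a, b, c], ∃ e₅ ∈ [0, 1, a, b, c], ∃ e₆ ∈ [0, 1, a, b, c], ∃ e₇ ∈ [0, 1, a, b, c], ∃ e₈ ∈ [0, 1, a, b, c], x + y + z + w + v + o + t + e₁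 + e₂ + e₃ + e₄ + e₅ + e₆ + e₇ + e₈ = r) := by
    rintro r hr ⟨i, j, k, l, n, o, q, i₁, j₁, k₁, l₁, n₁, o₁, q₁, i₂, hsum⟩
    have hi : cv i = d i := hcvd i (by omega)
    have hj : cv j = d j := hcvd j (by omega)
    have hk : cv k = d k := hcvd k (by omega)
    have hl : cv l = d l := hcvd l (by omega)
    have hn : cv n = d n := hcvd n (by omega)
    have ho : cv o = d o := hcvd o (by omega)
    have hq : cv q = d q := hcvd q (by omega)
    have hi₁ : cv i₁ = d i₁ := hcvd i₁ (by omega)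
    have hj₁ : cv j₁ = d j₁ := hcvd j₁ (by omega)
    have hk₁ : cv k₁ = d k₁ := hcvd k₁ (by omega)
    have hl₁ : cv l₁ = d l₁ := hcvd l₁ (by omega)
    have hn₁ : cv n₁ = d n₁ := hcvd n₁ (by omega)
    have ho₁ : cv o₁ = d o₁ := hcvd o₁ (by omega)
    have hq₁ : cv q₁ = d q₁ := hcvd q₁ (by omega)
    have hi₂ : cv i₂ = d i₂ := hcvd i₂ (by omega)
    have hin : ∀ u ∈ V, u ∈ [0, 1, a, b, c] := by
      intro u hu
      rcases hVW' u hu with h | h | h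
      · rw [h]; simp
      · rw [h]; simp
      · exact List.mem_cons_of_mem _ (List.mem_cons_of_mem _ ((hlmem u).mpr h))
    exact ⟨cv i, hin _ (hcvV i), cv j, hin _ (hcvV j), cv k, hin _ (hcvV k), cv l, hin _ (hcvV l), cv n, hin _ (hcvV n), cv o, hin _ (hcvV o), cv q, hin _ (hcvV q), cv i₁, hin _ (hcvV i₁), cv j₁, hin _ (hcvV j₁), cv k₁, hin _ (hcvV k₁), cv l₁, hin _ (hcvV l₁), cv n₁, hin _ (hcvV n₁), cv o₁, hin _ (hcvV o₁), cv q₁, hin _ (hcvV q₁), cv i₂, hin _ (hcvV i₂), by rw [hi, hj, hk, hl, hn, ho, hq, hi₁, hj₁, hk₁, hl₁, hn₁, ho₁, hq₁, hi₂]; exact hsum⟩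
  have hcovP : ∀ r, r ≤ 1384 → (∃ x ∈ [0, 1, a, b, c], ∃ y ∈ [0, 1, a, b, c], ∃ z ∈ [0, 1, a, b, c], ∃ w ∈ [0, 1, a, b, c], ∃ v ∈ [0, 1, a, b, c], ∃ o ∈ [0, 1, a, b, c], ∃ t ∈ [0, 1, a, b, c], ∃ e₁ ∈ [0, 1, a, b, c], ∃ e₂ ∈ [0, 1, a, b, c], ∃ e₃ ∈ [0, 1, a, b, c], ∃ e₄ ∈ [0, 1, a, b, c], ∃ e₅ ∈ [0, 1, a, b, c], ∃ e₆ ∈ [0, 1, a, b, c], ∃ e₇ ∈ [0, 1, a, b, c], ∃ e₈ ∈ [0, 1, a, b, c], x + y + z + w + v + o + t + e₁ + e₂ + e₃ + e₄ + e₅ + e₆ + e₇ + e₈ = r) := fun r hr => hmemP r hr (hmem r (by omega))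
  have hlt1 : a < b := by
    have := hlsort (show (⟨0, by simp⟩ : Fin [a, b, c].length) < ⟨1, by simp⟩ from Fin.mk_lt_mk.mpr (by norm_num))
    simpa using this
  have hlt2 : b < c := by
    have := hlsort (show (⟨1, by simp⟩ : Fin [a, b, c].length) < ⟨2, by simp⟩ from Fin.mk_lt_mk.mpr (by norm_num))
    simpa using this
  -- bound on the third value: `a ≤ 16` (cover at `16`)
  have hrestA : ∀ y ∈ [a, b, c], a ≤ y := by
    intro y hy
    simp only [List.mem_cons, List.mem_nil_iff, or_false] at hy
    omega
  have haM : a ≤ 16 := by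
    by_contra hh
    obtain ⟨x, hx, y, hy, z, hz, w, hw, v, hv, o, ho, t, ht, e₁, he₁, e₂, he₂, e₃, he₃, e₄, he₄, e₅, he₅, e₆, he₆, e₇, he₇, e₈, he₈, hsum⟩ := memP15_prefix (l₁ := [0, 1]) (l₂ := [a, b, c]) hrestA (show 16 < a by omega) (hcovP 16 (by omega))
    simp only [List.mem_cons, List.mem_nil_iff, or_false] at hx hy hz hw hv ho ht he₁ he₂ he₃ he₄ he₅ he₆ he₇ he₈
    (have hx' : x ≤ 1 := by rcases hx with hh0 | hh0 <;> omega); (have hy' : y ≤ 1 := by rcases hy with hh0 | hh0 <;> omega); (have hz' : z ≤ 1 := by rcases hz with hh0 | hh0 <;> omega); (have hw' : w ≤ 1 := by rcases hw with hh0 | hh0 <;> omega)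
    (have hv' : v ≤ 1 := by rcases hv with hh0 | hh0 <;> omega); (have ho' : o ≤ 1 := by rcases ho with hh0 | hh0 <;> omega); (have ht' : t ≤ 1 := by rcases ht with hh0 | hh0 <;> omega); (have he₁' : e₁ ≤ 1 := by rcases he₁ with hh0 | hh0 <;> omega)
    (have he₂' : e₂ ≤ 1 := by rcases he₂ with hh0 | hh0 <;> omega); (have he₃' : e₃ ≤ 1 := by rcases he₃ with hh0 | hh0 <;> omega); (have he₄' : e₄ ≤ 1 := by rcases he₄ with hh0 | hh0 <;> omega); (have he₅' : e₅ ≤ 1 := by rcases he₅ with hh0 | hh0 <;> omega)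
    (have he₆' : e₆ ≤ 1 := by rcases he₆ with hh0 | hh0 <;> omega); (have he₇' : e₇ ≤ 1 := by rcases he₇ with hh0 | hh0 <;> omega); (have he₈' : e₈ ≤ 1 := by rcases he₈ with hh0 | hh0 <;> omega); clear hx hy hz hw hv ho ht he₁ he₂ he₃ he₄ he₅ he₆ he₇ he₈
    omega
  have pre2 : (List.foldr (fun (x acc : ℕ) => acc ||| (List.foldr (fun (x acc : ℕ) => acc ||| (List.foldr (fun (x acc : ℕ) => acc ||| (List.foldr (fun (x acc : ℕ) => acc ||| (List.foldr (fun (x acc : ℕ) => acc ||| (List.foldr (fun (x acc : ℕ) => acc ||| (List.foldr (fun (x acc : ℕ) => acc ||| (List.foldr (fun (x acc : ℕ) => acc ||| (List.foldr (fun (x acc : ℕ) => acc ||| (List.foldr (fun (x acc : ℕ) => acc ||| (List.foldr (fun (x acc : ℕ) => acc ||| (List.foldr (fun (x acc : ℕ) => acc ||| (List.foldr (fun (x acc : ℕ) => acc ||| (List.foldr (fun (x acc : ℕ) => acc ||| (List.foldr (fun (y acc : ℕ) => acc ||| 2 ^ y) 0 [0, 1, a]) * 2 ^ x) 0 [0,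 1, a]) * 2 ^ x) 0 [0, 1, a]) * 2 ^ x) 0 [0, 1, a]) * 2 ^ x) 0 [0, 1, a]) * 2 ^ x) 0 [0, 1, a]) * 2 ^ x) 0 [0, 1, a]) * 2 ^ x) 0 [0, 1, a]) * 2 ^ x) 0 [0, 1, a]) * 2 ^ x) 0 [0, 1, a]) * 2 ^ x) 0 [0, 1, a]) * 2 ^ x) 0 [0, 1, a]) * 2 ^ x) 0 [0, 1, a]) * 2 ^ x) 0 [0, 1, a]) * 2 ^ x) 0 [0, 1, a] % 2 ^ (min 1385 b) = 2 ^ (min 1385 b) - 1) := by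
    apply maskFull_of_testBit
    intro r hr
    have hrN : r < 1385 := lt_of_lt_of_le hr (min_le_left _ _)
    have hrv : r < b := lt_of_lt_of_le hr (min_le_right _ _)
    have hrest : ∀ y ∈ [b, c], b ≤ y := by
      intro y hy
      simp only [List.mem_cons, List.mem_nil_iff, or_false] at hy
      omega
    exact testBit_fold15Shift_of_mem (memP15_prefix (l₁ := [0, 1, a]) (l₂ := [b, c]) hrest hrv (hcovP r (by omega)))
  have pre3 : (List.foldr (fun (x acc : ℕ) => acc ||| (List.foldr (fun (x acc : ℕ) => acc ||| (List.foldr (fun (x acc : ℕ) => acc ||| (List.foldr (fun (x acc : ℕ) => acc ||| (List.foldr (fun (x acc : ℕ) => acc ||| (List.foldr (fun (x acc : ℕ) => acc ||| (List.foldr (fun (x acc : ℕ) => acc ||| (List.foldr (fun (x acc : ℕ) => acc ||| (List.foldr (fun (x acc : ℕ) => acc ||| (List.foldr (fun (x acc : ℕ) => acc ||| (List.foldr (fun (x acc : ℕ) => acc ||| (List.foldr (fun (x acc : ℕ) => acc ||| (List.foldr (fun (x acc : ℕ) => acc ||| (List.foldr (fun (x acc : ℕ) => acc ||| (List.foldr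 (fun (y acc : ℕ) => acc ||| 2 ^ y) 0 [0, 1, a, b]) * 2 ^ x) 0 [0, 1, a, b]) * 2 ^ x) 0 [0, 1, a, b]) * 2 ^ x) 0 [0, 1, a, b]) * 2 ^ x) 0 [0, 1, a, b]) * 2 ^ x) 0 [0, 1, a, b]) * 2 ^ x) 0 [0, 1, a, b]) * 2 ^ x) 0 [0, 1, a, b]) * 2 ^ x) 0 [0, 1, a, b]) * 2 ^ x) 0 [0, 1, a, b]) * 2 ^ x) 0 [0, 1, a, b]) * 2 ^ x) 0 [0, 1, a, b]) * 2 ^ x) 0 [0, 1, a, b]) * 2 ^ x) 0 [0, 1, a, b]) * 2 ^ x) 0 [0, 1, a, b] % 2 ^ (min 1385 c) = 2 ^ (min 1385 c) - 1) := by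
    clear pre2
    apply maskFull_of_testBit
    intro r hr
    have hrN : r < 1385 := lt_of_lt_of_le hr (min_le_left _ _)
    have hrv : r < c := lt_of_lt_of_le hr (min_le_right _ _)
    have hrest : ∀ y ∈ [c], c ≤ y := by
      intro y hy
      simp only [List.mem_cons, List.mem_nil_iff, or_false] at hy
      omega
    exact testBit_fold15Shift_of_mem (memP15_prefix (l₁ := [0, 1, a, b]) (l₂ := [c]) hrest hrv (hcovP r (by omega)))
  have hcovT : (List.foldr (fun (x acc : ℕ) => acc ||| (List.foldr (fun (x acc : ℕ) => acc ||| (List.foldr (fun (x acc : ℕ) => acc ||| (List.foldr (fun (x acc : ℕ) => acc ||| (List.foldr (fun (x acc : ℕ) => acc ||| (List.foldr (fun (x acc : ℕ) => acc ||| (List.foldr (fun (x acc : ℕ) => acc ||| (List.foldr (fun (x acc : ℕ) => acc ||| (List.foldr (fun (x acc : ℕ) => acc ||| (List.foldr (fun (x acc : ℕ) => acc ||| (List.foldr (fun (x acc : ℕ) => acc ||| (List.foldr (fun (x acc : ℕ) => acc ||| (List.foldr (fun (x acc : ℕ) => acc ||| (List.foldr (fun (x acc : ℕ) => acc ||| (List.foldr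 (fun (y acc : ℕ) => acc ||| 2 ^ y) 0 [0, 1, a, b, c]) * 2 ^ x) 0 [0, 1, a, b, c]) * 2 ^ x) 0 [0, 1, a, b, c]) * 2 ^ x) 0 [0, 1, a, b, c]) * 2 ^ x) 0 [0, 1, a, b, c]) * 2 ^ x) 0 [0, 1, a, b, c]) * 2 ^ x) 0 [0, 1, a, b, c]) * 2 ^ x) 0 [0, 1, a, b, c]) * 2 ^ x) 0 [0, 1, a, b, c]) * 2 ^ x) 0 [0, 1, a, b, c]) * 2 ^ x) 0 [0, 1, a, b, c]) * 2 ^ x) 0 [0, 1, a, b, c]) * 2 ^ x) 0 [0, 1, a, b, c]) * 2 ^ x) 0 [0, 1, a, b, c]) * 2 ^ x) 0 [0, 1, a, b, c] % 2 ^ 1385 = 2 ^ 1385 - 1) := by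
    clear pre2 pre3
    exact maskFull_of_testBit (fun r hr => testBit_fold15Shift_of_mem (hcovP r (by omega)))
  interval_cases a
  · exact stampCheck_fifteen_five_s2 b (hmemR b (by simp)) ⟨hlt1, pre2⟩ c (hmemR c (by simp)) ⟨hlt2, pre3⟩ hcovT
  · exact stampCheck_fifteen_five_s3 b (hmemR b (by simp)) ⟨hlt1, pre2⟩ c (hmemR c (by simp)) ⟨hlt2, pre3⟩ hcovT
  · exact stampCheck_fifteen_five_s4 b (hmemR b (by simp)) ⟨hlt1, pre2⟩ c (hmemR c (by simp)) ⟨hlt2, pre3⟩ hcovT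
  · exact stampCheck_fifteen_five_s5 b (hmemR b (by simp)) ⟨hlt1, pre2⟩ c (hmemR c (by simp)) ⟨hlt2, pre3⟩ hcovT
  · exact stampCheck_fifteen_five_s6 b (hmemR b (by simp)) ⟨hlt1, pre2⟩ c (hmemR c (by simp)) ⟨hlt2, pre3⟩ hcovT
  · exact stampCheck_fifteen_five_s7 b (hmemR b (by simp)) ⟨hlt1, pre2⟩ c (hmemR c (by simp)) ⟨hlt2, pre3⟩ hcovT
  · exact stampCheck_fifteen_five_s8 b (hmemR b (by simp)) ⟨hlt1, pre2⟩ c (hmemR c (by simp)) ⟨hlt2, pre3⟩ hcovT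
  · exact stampCheck_fifteen_five_s9 b (hmemR b (by simp)) ⟨hlt1, pre2⟩ c (hmemR c (by simp)) ⟨hlt2, pre3⟩ hcovT
  · exact stampCheck_fifteen_five_s10 b (hmemR b (by simp)) ⟨hlt1, pre2⟩ c (hmemR c (by simp)) ⟨hlt2, pre3⟩ hcovT
  · exact stampCheck_fifteen_five_s11 b (hmemR b (by simp)) ⟨hlt1, pre2⟩ c (hmemR c (by simp)) ⟨hlt2, pre3⟩ hcovT
  · exact stampCheck_fifteen_five_s12 b (hmemR b (by simp)) ⟨hlt1, pre2⟩ c (hmemR c (by simp)) ⟨hlt2, pre3⟩ hcovT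
  · exact stampCheck_fifteen_five_s13 b (hmemR b (by simp)) ⟨hlt1, pre2⟩ c (hmemR c (by simp)) ⟨hlt2, pre3⟩ hcovT
  · exact stampCheck_fifteen_five_s14 b (hmemR b (by simp)) ⟨hlt1, pre2⟩ c (hmemR c (by simp)) ⟨hlt2, pre3⟩ hcovT
  · exact stampCheck_fifteen_five_s15 b (hmemR b (by simp)) ⟨hlt1, pre2⟩ c (hmemR c (by simp)) ⟨hlt2, pre3⟩ hcovT
  · exact stampCheck_fifteen_five_s16 b (hmemR b (by simp)) ⟨hlt1, pre2⟩ c (hmemR c (by simp)) ⟨hlt2, pre3⟩ hcovT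

end Summit.ValiantsHypothesis.ValiantsHypothesis.Theorems.LacunarySymmetroidMatrixDescartes.FiniteSector
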